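import Summits.ResolutionOfSingularities.ResolutionOfSingularities.Theorems.PurelyInseparableDim4ResConeCInfVirtualEntryRotationPrime
import Summits.ResolutionOfSingularities.ResolutionOfSingularities.Theorems.PurelyInseparableDim4ResConeCInfEntryAt
import HarnessLib
import HarnessLib.Audit.Tags

/-!
# Purely inseparable four-folds — THE C∞ FRAMED ENTRY AT A LATE TIME OF THE CHAIN, EVERY PRIME (ENTRY-5a of the power-cone
# light-pair line «light pair of TAIL(p, p−1, 3) ∀ p»): letters, power cone, K11-lin ledger and the step kind read off the
# chain binders; the `(5,4)` instance is res-dim4-p-3 g4's `ResCone.cInf_entry_at` (`…ResConeCInfEntryAt` p702709) WITHOUT its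
# flag/second-Tschirnhaus half (cell `res-dim4-pi`, K2(p) lane, rung 1)

[OURS · counted 0 · cell `res-dim4-pi` · K2(p) lane (holder res-dim4-p-12 g5, line booked g5-2 (6)); seat res-dim4-p-3 g5.]
Nothing here proves K2(p) for any `p`, any TAIL(p, p−1, 3), any TAIL(7, d, e), `NoIsolatedTrap p p`, the
Cossart–Jannsen–Saito theorem or resolution of singularities in dimension ≥ 4 / characteristic `p` — NOT proved.  AI kernel
work, weaker than expert review.  ENTRY bookkeeping: kills nothing by itself.

**`exists_cInf_framed_entry_at_prime`** (`d + 1 = p`, `2 ≤ d`).  Along a witnessed isolated `Step0 p` chain in the light-pair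
power-cone regime (shade `≡ d`, `e_G ≡ 3`, weights `≤ 1` of total `2` from `k₀`, slots born from `k₁ ≥ k₀`), at every time
`k′ ≥ k₁`, `k′ ≥ 1`: four letters `λ μ u f`, a bijection `π₀` with `(c (k′+1)).r = e_{π₀λ} + e_{π₀μ}`, and FOR EVERY PRECISION
`M` a slot letter `κ ∈ {λ, μ}`, a state `A₁` ℛ²-RELATED to the real child `c (k′+1)` along `π₀` at precision `M` (slot-unit
frame, invertible free block; `A₁ = c (k′+1)` itself after a SLOT step, res-dim4-typ-1 g5's virtual slot child after a
ROTATION), and the FRAMED PURE-CORNER CHILD `C₁ = step p univ κ 0 S₂` of ENTRY-2/ENTRY-4 re-presenting `A₁`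
(`C₁.F = clean (tsch f Φ A₁.F)`): `S₂` and `C₁` straight (`resForm = a·x_f^d`, `a ≠ 0`), exact pair ledger, order `d + 2`,
`r = x_λx_μ ∣ F`, `C₁` isolated with `e_G = 3`.  NO FLAG is asserted (Q-FLAG at `d ≥ 6`, bus 2026-08-29 10:47Z — OPEN): the
window's `hE` follows from this block PLUS a flagged row of `C₁` by ENTRY-4 §1 `exists_cInf_virtual_entry_of_rel_prime`.
ROUTE = the `p = 5` one: slots of `c k′` (`exists_pair_letters`), births (`hborn`), contact letter `f` with `ℓ_{k′} f ≠ 0`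
(`contactSupport_not_subset_pair` on `chain_powerCone_package`), fourth letter `u`, K11-lin ledger
(`stretch_pair_ledger_linear`), order `d + 2` (`chain_shade_nat`), cleanliness (`deletePthPowers_step_F`), then res-dim4-typ-1
g5's `SwapTransport.step_cases_of_weights_prime` on the step `k′`: SLOT ⇒ ENTRY-2 with the trivial relation (`π₀ = 1`);
ROTATION ⇒ ENTRY-4 §2 (`π₀ = (κ g)`, certificate level by `IsolationConverse.exists_certificate_of_isIsolated`).
[cite: CossartJannsenSaito2020, Thm. 3.14, Lemma 13.2] [cite: Hauser2010, §§F–G]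
bears_on: LADDER-RESOLUTION:D157-DOOR2 (res-dim4-pi · K2(p) · power cones · C∞ framed entry at a late time, every prime).
Supports stmt-ResolutionOfSingularities-16155 (helper).
-/

set_option linter.dupNamespace false -- mandated namespace of this single-conjunct summit

noncomputable section

namespace Summit.ResolutionOfSingularities.ResolutionOfSingularities.Theorems.PIDim4

namespace ResCone

open MvPolynomial Finset FrameChange
open Literature.AlgebraicGeometry.Resolution
open Literature.AlgebraicGeometry.Resolution.CentreBlowup
open Literature.AlgebraicGeometry.Resolution.Hauser2010
open Literature.AlgebraicGeometry.Resolution.HauserPerlega2019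

variable {K : Type} [Field K] [DecidableEq K]

/-- **THE C∞ FRAMED ENTRY AT A LATE TIME OF THE CHAIN, every prime** (statement and route in the module docstring). [OURS]
[cite: CossartJannsenSaito2020, Thm. 3.14, Lemma 13.2] [cite: Hauser2010, §§F–G] -/
theorem exists_cInf_framed_entry_at_prime (p : ℕ) [hp : Fact p.Prime] [CharP K p] {d : ℕ} (hdp : d + 1 = p) (hd2 : 2 ≤ d)
    {c : ℕ → State K} {j : ℕ → Fin 4} {b : ℕ → Fin 4 → K}
    (hc : ∀ k, IsIsolated p (c k).F ∧ Step0 p (c k) (c (k + 1))) (hw : FreeTail.IsWitnessedChain p c j b)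
    (hr0 : ∀ e ∈ (c 0).F.support, (c 0).r ≤ e) (hfloor : ∀ k, ordZero (c k).F ≠ (p : ℕ)) {k₀ : ℕ}
    (hshade : ∀ k, k₀ ≤ k → (c k).shade = ((d : ℕ) : ℕ∞))
    (he3 : ∀ k, k₀ ≤ k → Module.finrank K (resVertex (c k)) = 3) {k₁ : ℕ} (hk₁ : k₀ ≤ k₁)
    (hwt : ∀ k, k₀ ≤ k → (∀ i, (c k).r i ≤ 1) ∧ (c k).r.degree = 2)
    (hborn : ∀ k, k₁ ≤ k → ∀ i, 1 ≤ (c k).r i →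
      ∃ t, k₀ ≤ t ∧ t < k ∧ j t = i ∧ ∀ m, t < m → m < k → j m ≠ i ∧ b m i = 0)
    {k' : ℕ} (hk' : k₁ ≤ k') (hk'1 : 1 ≤ k') :
    ∃ (la mu u f : Fin 4) (π₀ : Equiv.Perm (Fin 4)), la ≠ mu ∧ la ≠ u ∧ la ≠ f ∧ mu ≠ u ∧ mu ≠ f ∧ u ≠ f ∧
      (c (k' + 1)).r = Finsupp.single (π₀ la) 1 + Finsupp.single (π₀ mu) 1 ∧
      ∀ M : ℕ, ∃ (κ : Fin 4) (A₁ S₂ C₁ : State K) (Φ : MvPolynomial (Fin 4) K) (θ' e' : Fin 4 → MvPolynomial (Fin 4) K)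
        (U' E' : MvPolynomial (Fin 4) K) (a : K),
        (κ = la ∨ κ = mu) ∧
        -- the ℛ²-relation of `A₁` to the real child along `π₀` at precision `M`
        θ' (π₀ la) = X la * e' la ∧ θ' (π₀ mu) = X mu * e' mu ∧ constantCoeff (e' la) ≠ 0 ∧ constantCoeff (e' mu) ≠ 0 ∧
        constantCoeff (θ' (π₀ u)) = 0 ∧ constantCoeff (θ' (π₀ f)) = 0 ∧
        coeff (Finsupp.single u 1) (θ' (π₀ u)) * coeff (Finsupp.single f 1) (θ' (π₀ f)) -
          coeff (Finsupp.single f 1) (θ' (π₀ u)) * coeff (Finsupp.single u 1) (θ' (π₀ f)) ≠ 0 ∧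
        constantCoeff U' ≠ 0 ∧ E' ∈ originIdeal K ^ M ∧ A₁.F = deletePthPowers p (U' ^ p * aeval θ' (c (k' + 1)).F) + E' ∧
        -- the framed pure-corner child re-presenting `A₁`
        C₁ = CentreBlowup.step p Finset.univ κ 0 S₂ ∧
        S₂.r = Finsupp.single la 1 + Finsupp.single mu 1 ∧ (∀ e ∈ S₂.F.support, S₂.r ≤ e) ∧
        ordZero S₂.F = ((d + 2 : ℕ) : ℕ∞) ∧ a ≠ 0 ∧ resForm S₂ = C a * X f ^ d ∧
        (∀ e ∈ S₂.F.support, e f ≤ d - 1 → 2 ≤ e la ∧ 2 ≤ e mu) ∧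
        f ∉ Φ.vars ∧ constantCoeff Φ = 0 ∧ C₁.F = deletePthPowers p (tsch f Φ A₁.F) ∧
        ordZero C₁.F = ((d + 2 : ℕ) : ℕ∞) ∧ C₁.r = Finsupp.single la 1 + Finsupp.single mu 1 ∧
        (∀ e ∈ C₁.F.support, C₁.r ≤ e) ∧ resForm C₁ = C a * X f ^ d ∧
        (∀ e ∈ C₁.F.support, e f ≤ d - 1 → 2 ≤ e la ∧ 2 ≤ e mu) ∧
        IsIsolated p C₁.F ∧ Module.finrank K (resVertex C₁) = 3 := by
  have hdlt : d < p := by omega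
  have hiso : ∀ k, IsIsolated p (c k).F := fun k => (hc k).1
  have hbj : ∀ k, b k (j k) = 0 := fun k => (hw k).2.1
  have hstep : ∀ k, c (k + 1) = CentreBlowup.step p Finset.univ (j k) (b k) (c k) := fun k => (hw k).2.2.2.2
  have hdivk : ∀ k, ∀ e ∈ (c k).F.support, (c k).r ≤ e := IsolatedBand.isolated_chain_forall_le hc hr0
  have ho : ∀ k, k₀ ≤ k → ordZero (c k).F = ((d + 2 : ℕ) : ℕ∞) := fun k hk => by
    obtain ⟨o, ho, hpo, -, hod⟩ := chain_shade_nat p hc hfloor hshade hk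
    rw [(hwt k hk).2] at hod
    rw [ho]; congr 1; omega
  have hop : ∀ k, k₀ ≤ k → ordZero (c k).F = ((p + 1 : ℕ) : ℕ∞) := fun k hk => by
    rw [ho k hk, show d + 2 = p + 1 by omega]
  have hk'₀ : k₀ ≤ k' := hk₁.trans hk'
  have hk'₀1 : k₀ ≤ k' + 1 := by omega
  -- (1) the slots of `c k′`, the power-cone package, the births, the contact letter `f`, the fourth letter `u`
  obtain ⟨la, mu, hlm, hrk'⟩ := exists_pair_letters (hwt k' hk'₀).1 (hwt k' hk'₀).2
  obtain ⟨ℓ, a0, lam, hpkg⟩ := chain_powerCone_package p hc hw hr0 hfloor hdlt hshade he3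
  have hform : ∀ k, k₀ ≤ k → resForm (c k) = C (a0 k) * (∑ i, C (ℓ k i) * X i) ^ d := fun k hk => (hpkg k hk).2.2.1
  have hdir : ∀ k, k₀ ≤ k → ℓ k (j k) + dotProduct (ℓ k) (b k) = 0 := fun k hk => (hpkg k hk).2.2.2.1
  have hlam : ∀ k, k₀ ≤ k → lam k ≠ 0 := fun k hk => (hpkg k hk).2.2.2.2.1
  have hprop : ∀ k, k₀ ≤ k → ∀ i, i ≠ j k → ℓ (k + 1) i = lam k * ℓ k i := fun k hk => (hpkg k hk).2.2.2.2.2.1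
  have hcarry : ∀ k, k₀ ≤ k → ∃ i, i ≠ j k ∧ ℓ k i ≠ 0 := fun k hk => (hpkg k hk).2.2.2.2.2.2
  obtain ⟨ta, hta, htak, hja, hkepta⟩ := hborn k' hk' la (Nat.one_le_iff_ne_zero.mpr (by
    rw [hrk', Finsupp.add_apply, Finsupp.single_eq_same, Finsupp.single_eq_of_ne hlm]; omega))
  obtain ⟨tb, htb, htbk, hjb, hkeptb⟩ := hborn k' hk' mu (Nat.one_le_iff_ne_zero.mpr (by
    rw [hrk', Finsupp.add_apply, Finsupp.single_eq_of_ne (Ne.symm hlm), Finsupp.single_eq_same]; omega))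
  have hf : ∃ f : Fin 4, f ≠ la ∧ f ≠ mu ∧ ℓ k' f ≠ 0 := by
    rcases Nat.lt_or_gt_of_ne (show ta ≠ tb from fun h => hlm (by rw [← hja, ← hjb, h])) with hlt | hlt
    · obtain ⟨m, h1, h2, h3⟩ := contactSupport_not_subset_pair hdir hlam hprop hcarry hbj hta hlt htbk
        (fun m hm hmk => by rw [hja]; exact hkepta m hm hmk) (fun m hm hmk => by rw [hjb]; exact hkeptb m hm hmk)
      exact ⟨m, by rw [← hja]; exact h1, by rw [← hjb]; exact h2, h3⟩
    · obtain ⟨m, h1, h2, h3⟩ := contactSupport_not_subset_pair hdir hlam hprop hcarry hbj htb hlt htak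
        (fun m hm hmk => by rw [hjb]; exact hkeptb m hm hmk) (fun m hm hmk => by rw [hja]; exact hkepta m hm hmk)
      exact ⟨m, by rw [← hja]; exact h2, by rw [← hjb]; exact h1, h3⟩
  obtain ⟨f, hfl, hfm, hℓf⟩ := hf
  obtain ⟨u, hul, hum, huf, -⟩ := exists_fourth_letter hlm hfl.symm hfm.symm
  -- (2) the K11-lin ledger, cleanliness, the child's weights
  obtain ⟨U, S, T, hU, hledger⟩ := stretch_pair_ledger_linear p hc hw hr0 hfloor (by omega : 1 ≤ d) hshade hform
    hdir hlam hprop hcarry hlm hfl hfm hℓf hta htak hja hkepta htb htbk hjb hkeptb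
  have hclean : deletePthPowers p (c k').F = (c k').F := by
    obtain ⟨k'', rfl⟩ : ∃ k'', k' = k'' + 1 := ⟨k' - 1, by omega⟩
    rw [hstep k'']
    exact FrameChange.deletePthPowers_step_F p Finset.univ (j k'') (b k'') (c k'')
  have hw1 : ∀ i, (CentreBlowup.step p Finset.univ (j k') (b k') (c k')).r i ≤ 1 := by
    rw [← hstep k']; exact (hwt (k' + 1) hk'₀1).1
  have hdeg : (CentreBlowup.step p Finset.univ (j k') (b k') (c k')).r.degree = 2 := by
    rw [← hstep k']; exact (hwt (k' + 1) hk'₀1).2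
  -- the trivial relation of the real child to itself (slot case)
  have htriv : ∀ x : Fin 4, (X : Fin 4 → MvPolynomial (Fin 4) K) ((1 : Equiv.Perm (Fin 4)) x) =
      X x * (fun _ => (1 : MvPolynomial (Fin 4) K)) x := fun x => by rw [Equiv.Perm.one_apply, mul_one]
  have hone : constantCoeff ((fun _ => (1 : MvPolynomial (Fin 4) K)) la) ≠ 0 := by
    dsimp only; rw [map_one]; exact one_ne_zero
  have hX0 : ∀ x : Fin 4, constantCoeff ((X : Fin 4 → MvPolynomial (Fin 4) K) ((1 : Equiv.Perm (Fin 4)) x)) = 0 :=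
    fun x => by rw [Equiv.Perm.one_apply]; exact constantCoeff_X (R := K) x
  have hdet1 : coeff (Finsupp.single u 1) ((X : Fin 4 → MvPolynomial (Fin 4) K) ((1 : Equiv.Perm (Fin 4)) u)) *
        coeff (Finsupp.single f 1) ((X : Fin 4 → MvPolynomial (Fin 4) K) ((1 : Equiv.Perm (Fin 4)) f)) -
      coeff (Finsupp.single f 1) ((X : Fin 4 → MvPolynomial (Fin 4) K) ((1 : Equiv.Perm (Fin 4)) u)) *
        coeff (Finsupp.single u 1) ((X : Fin 4 → MvPolynomial (Fin 4) K) ((1 : Equiv.Perm (Fin 4)) f)) ≠ 0 := by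
    have h1 : coeff (Finsupp.single f 1) (X u : MvPolynomial (Fin 4) K) = 0 := by
      rw [coeff_X, if_neg]; exact fun h => huf (Finsupp.single_left_injective one_ne_zero h)
    rw [Equiv.Perm.one_apply, Equiv.Perm.one_apply, coeff_X_same, coeff_X_same, h1, zero_mul, sub_zero, mul_one]
    exact one_ne_zero
  have hU1 : constantCoeff (1 : MvPolynomial (Fin 4) K) ≠ 0 := by rw [map_one]; exact one_ne_zero
  have hrel1 : ∀ M : ℕ, (0 : MvPolynomial (Fin 4) K) ∈ originIdeal K ^ M ∧
      (c (k' + 1)).F = deletePthPowers p ((1 : MvPolynomial (Fin 4) K) ^ p *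
        aeval (X : Fin 4 → MvPolynomial (Fin 4) K) (c (k' + 1)).F) + 0 := fun M => by
    refine ⟨Submodule.zero_mem _, ?_⟩
    rw [one_pow, one_mul, MvPolynomial.aeval_X_left, AlgHom.id_apply, add_zero, hstep k']
    exact (FrameChange.deletePthPowers_step_F p Finset.univ (j k') (b k') (c k')).symm
  -- (3) the step kind (res-dim4-typ-1 g5)
  rcases SwapTransport.step_cases_of_weights_prime p hlm hul.symm hfl.symm hum.symm hfm.symm huf hrk' (hop k' hk'₀) hw1 hdeg
    with ⟨hjla, hbmu, hr'⟩ | ⟨hjmu, hbla, hr'⟩ | ⟨hjuf, ⟨hbla, hbmu, hr'⟩ | ⟨hbmu, hbla, hr'⟩⟩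
  · -- SLOT step in the chart `λ`
    have hbla : b k' la = 0 := by rw [← hjla]; exact hbj k'
    refine ⟨la, mu, u, f, 1, hlm, hul.symm, hfl.symm, hum.symm, hfm.symm, huf, ?_, fun M => ?_⟩
    · rw [Equiv.Perm.one_apply, Equiv.Perm.one_apply, hstep k']; exact hr'
    · obtain ⟨S₂, C₁, Φ, hC₁, hrS₂, hdivS₂, hoS₂, hresS₂, hledS₂, hΦvars, hΦ0, hC₁F, hoC₁, hrC₁, hdivC₁, hA0, hresC₁, hledC₁,
          hisoC₁, he3C₁⟩ :=
        exists_cInf_framed_child_prime p hdp hd2 hlm hul.symm hfl.symm hum.symm hfm.symm huf (κ := la) (Or.inl rfl)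
          (A' := c k') (A := c (k' + 1)) (β := b k') hbla hbla hbmu (by rw [← hjla]; exact hstep k') hrk'
          (by rw [hstep k']; exact hr') (hdivk k') (hdivk (k' + 1)) (ho k' hk'₀) (ho (k' + 1) hk'₀1) hclean
          (hiso (k' + 1)) (he3 (k' + 1) hk'₀1) (hform k' hk'₀) hℓf hU hledger
      exact ⟨la, c (k' + 1), S₂, C₁, Φ, X, fun _ => 1, 1, 0, _, Or.inl rfl, htriv la, htriv mu, hone, hone, hX0 u, hX0 f,
        hdet1, hU1, (hrel1 M).1, (hrel1 M).2, hC₁, hrS₂, hdivS₂, hoS₂, hA0, hresS₂, hledS₂, hΦvars, hΦ0, hC₁F, hoC₁, hrC₁,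
        hdivC₁, hresC₁, hledC₁, hisoC₁, he3C₁⟩
  · -- SLOT step in the chart `μ`
    have hbmu : b k' mu = 0 := by rw [← hjmu]; exact hbj k'
    refine ⟨la, mu, u, f, 1, hlm, hul.symm, hfl.symm, hum.symm, hfm.symm, huf, ?_, fun M => ?_⟩
    · rw [Equiv.Perm.one_apply, Equiv.Perm.one_apply, hstep k']; exact hr'
    · obtain ⟨S₂, C₁, Φ, hC₁, hrS₂, hdivS₂, hoS₂, hresS₂, hledS₂, hΦvars, hΦ0, hC₁F, hoC₁, hrC₁, hdivC₁, hA0, hresC₁, hledC₁,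
          hisoC₁, he3C₁⟩ :=
        exists_cInf_framed_child_prime p hdp hd2 hlm hul.symm hfl.symm hum.symm hfm.symm huf (κ := mu) (Or.inr rfl)
          (A' := c k') (A := c (k' + 1)) (β := b k') hbmu hbla hbmu (by rw [← hjmu]; exact hstep k') hrk'
          (by rw [hstep k']; exact hr') (hdivk k') (hdivk (k' + 1)) (ho k' hk'₀) (ho (k' + 1) hk'₀1) hclean
          (hiso (k' + 1)) (he3 (k' + 1) hk'₀1) (hform k' hk'₀) hℓf hU hledger
      exact ⟨mu, c (k' + 1), S₂, C₁, Φ, X, fun _ => 1, 1, 0, _, Or.inr rfl, htriv la, htriv mu, hone, hone, hX0 u, hX0 f,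
        hdet1, hU1, (hrel1 M).1, (hrel1 M).2, hC₁, hrS₂, hdivS₂, hoS₂, hA0, hresS₂, hledS₂, hΦvars, hΦ0, hC₁F, hoC₁, hrC₁,
        hdivC₁, hresC₁, hledC₁, hisoC₁, he3C₁⟩
  · -- ROTATION dropping `λ` (`b λ ≠ 0`)
    have hrA : (c (k' + 1)).r = Finsupp.single (j k') 1 + Finsupp.single mu 1 := by rw [hstep k']; exact hr'
    have hjl : j k' ≠ la := by rcases hjuf with h | h <;> rw [h]; exacts [hul, hfl]
    have hjm : j k' ≠ mu := by rcases hjuf with h | h <;> rw [h]; exacts [hum, hfm]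
    refine ⟨la, mu, u, f, Equiv.swap la (j k'), hlm, hul.symm, hfl.symm, hum.symm, hfm.symm, huf, ?_, fun M => ?_⟩
    · rw [Equiv.swap_apply_left, Equiv.swap_apply_of_ne_of_ne hlm.symm hjm.symm]; exact hrA
    · obtain ⟨Nc, hcert⟩ := IsolationConverse.exists_certificate_of_isIsolated (hiso (k' + 1))
      have hg : (j k' = u ∧ (if j k' = u then f else u) = f) ∨ (j k' = f ∧ (if j k' = u then f else u) = u) := by
        rcases hjuf with h | h
        · exact Or.inl ⟨h, by rw [if_pos h]⟩
        · exact Or.inr ⟨h, by rw [if_neg (by rw [h]; exact huf.symm)]⟩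
      obtain ⟨A₁, S₂, C₁, Φ, θ', e', U', E', hsla, hsmu, hela, hemu, hu0', hf0', hdet', hU', hE', hrel', -, hC₁, hrS₂,
          hdivS₂, hoS₂, hresS₂, hledS₂, hΦvars, hΦ0, hC₁F, hoC₁, hrC₁, hdivC₁, hA0, hresC₁, hledC₁, hisoC₁, he3C₁⟩ :=
        exists_cInf_framed_child_of_rotation_prime p hdp hd2 hlm hul.symm hfl.symm hum.symm hfm.symm huf (κ := la)
          (κ' := mu) (Or.inl ⟨rfl, rfl⟩) hg (P := c k') (A := c (k' + 1)) (b := b k') (hbj k') hbla hbmu (hstep k') hrk'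
          (hdivk k') (ho k' hk'₀) hclean (hiso (k' + 1)) hcert (ho (k' + 1) hk'₀1) (he3 (k' + 1) hk'₀1) hrA (hdivk (k' + 1))
          (hform k' hk'₀) hℓf hU hledger M
      exact ⟨la, A₁, S₂, C₁, Φ, θ', e', U', E', _, Or.inl rfl, hsla, hsmu, hela, hemu, hu0', hf0', hdet', hU', hE', hrel',
        hC₁, hrS₂, hdivS₂, hoS₂, hA0, hresS₂, hledS₂, hΦvars, hΦ0, hC₁F, hoC₁, hrC₁, hdivC₁, hresC₁, hledC₁, hisoC₁, he3C₁⟩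
  · -- ROTATION dropping `μ` (`b μ ≠ 0`)
    have hrA : (c (k' + 1)).r = Finsupp.single (j k') 1 + Finsupp.single la 1 := by rw [hstep k']; exact hr'
    have hjl : j k' ≠ la := by rcases hjuf with h | h <;> rw [h]; exacts [hul, hfl]
    have hjm : j k' ≠ mu := by rcases hjuf with h | h <;> rw [h]; exacts [hum, hfm]
    refine ⟨la, mu, u, f, Equiv.swap mu (j k'), hlm, hul.symm, hfl.symm, hum.symm, hfm.symm, huf, ?_, fun M => ?_⟩
    · rw [Equiv.swap_apply_left, Equiv.swap_apply_of_ne_of_ne hlm hjl.symm]; exact hrA.trans (add_comm _ _)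
    · obtain ⟨Nc, hcert⟩ := IsolationConverse.exists_certificate_of_isIsolated (hiso (k' + 1))
      have hg : (j k' = u ∧ (if j k' = u then f else u) = f) ∨ (j k' = f ∧ (if j k' = u then f else u) = u) := by
        rcases hjuf with h | h
        · exact Or.inl ⟨h, by rw [if_pos h]⟩
        · exact Or.inr ⟨h, by rw [if_neg (by rw [h]; exact huf.symm)]⟩
      obtain ⟨A₁, S₂, C₁, Φ, θ', e', U', E', hsla, hsmu, hela, hemu, hu0', hf0', hdet', hU', hE', hrel', -, hC₁, hrS₂,
          hdivS₂, hoS₂, hresS₂, hledS₂, hΦvars, hΦ0, hC₁F, hoC₁, hrC₁, hdivC₁, hA0, hresC₁, hledC₁, hisoC₁, he3C₁⟩ :=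
        exists_cInf_framed_child_of_rotation_prime p hdp hd2 hlm hul.symm hfl.symm hum.symm hfm.symm huf (κ := mu)
          (κ' := la) (Or.inr ⟨rfl, rfl⟩) hg (P := c k') (A := c (k' + 1)) (b := b k') (hbj k') hbmu hbla (hstep k') hrk'
          (hdivk k') (ho k' hk'₀) hclean (hiso (k' + 1)) hcert (ho (k' + 1) hk'₀1) (he3 (k' + 1) hk'₀1) hrA (hdivk (k' + 1))
          (hform k' hk'₀) hℓf hU hledger M
      exact ⟨mu, A₁, S₂, C₁, Φ, θ', e', U', E', _, Or.inr rfl, hsla, hsmu, hela, hemu, hu0', hf0', hdet', hU', hE', hrel',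
        hC₁, hrS₂, hdivS₂, hoS₂, hA0, hresS₂, hledS₂, hΦvars, hΦ0, hC₁F, hoC₁, hrC₁, hdivC₁, hresC₁, hledC₁, hisoC₁, he3C₁⟩

end ResCone

end Summit.ResolutionOfSingularities.ResolutionOfSingularities.Theorems.PIDim4

end
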